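import Summits.PneNP.PneNP.Theorems.RootDecompSegregatorSmallSegregators.Negative.KSS1

/-!
# K\*\* — proofs 2/6 (`KSS2`)

Proof file 2/6 of the kernel refutation of the route item `RootDecompSegregator.SmallSegregators`
(stmt-PneNP-26297; deciding theorem `Summit.PneNP.PneNP.Theorems.RootDecompSegregatorSmallSegregators_refuted`
in `Theorems/RootDecompSegregatorSmallSegregatorsRefutation.lean`; definitions in `Defs.lean` of this
directory).  Topic: lemmas `card_Bltot_le` … `lower_bound_G`.

PROVENANCE.  Mathematics and Lean text by the decomp-pnenp cell's lens-1 lineage (work file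
`decomp-pnenp-lens-1/SegregatorPageThreshold.lean`, generations 4–5, v5 sha256 `099856e2…`, brief
`KSS-DoubleButterfly.md`): the dependency cone of its theorem `not_smallSegregators`, extracted verbatim by
the cell critic and split into files of at most 400 lines (docstrings added where missing).  No declaration
here mentions a Theses item; the chain ends in `ancestorRobust_three : AncestorRobust 3 160 12` (last file),
from which the flat refutation file concludes `¬ SmallSegregators` by the kill switch
`not_smallSegregatorsAt_of_ancestorRobust` at `r = 3`, `k = 172`.
-/

namespace Summit.PneNP.PneNP.Theorems.RootDecompSegregatorSmallSegregators.Negative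

open Relation
open StackOp

section KSSCount
open Finset

section Count
variable {L T κ : ℕ} {E : Finset (ℕ × ℕ)} (D : ChargedDB L T κ E) (J : Finset ℕ)

/-- (P1) Few blocked vertices: every blocked vertex is charged to a step of `J`. -/
theorem card_Bltot_le : (Bltot D J).card ≤ κ * J.card := by
  classical
  have hsub : Bltot D J ⊆ J.biUnion (fun t => ((range (2 * L + 1)) ×ˢ (range (2 ^ L))).filter
      (fun p => t = D.β p.1 p.2 ∨ t ∈ D.carrier p.1 p.2)) := by
    intro p hp
    unfold Bltot at hp
    rw [mem_filter] at hp
    obtain ⟨hp, hb⟩ := hp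
    rw [mem_biUnion]
    rcases hb with hb | ⟨t, ht⟩
    · exact ⟨_, hb, mem_filter.2 ⟨hp, Or.inl rfl⟩⟩
    · rw [mem_inter] at ht
      exact ⟨t, ht.2, mem_filter.2 ⟨hp, Or.inr ht.1⟩⟩
  calc (Bltot D J).card ≤ _ := card_le_card hsub
    _ ≤ ∑ t ∈ J, (((range (2 * L + 1)) ×ˢ (range (2 ^ L))).filter
        (fun p => t = D.β p.1 p.2 ∨ t ∈ D.carrier p.1 p.2)).card := card_biUnion_le
    _ ≤ ∑ _t ∈ J, κ := sum_le_sum (fun t _ => by convert D.charge t)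
    _ = κ * J.card := by rw [sum_const, smul_eq_mul, mul_comm]

variable {D J}

/-- K\*\* cone (auxiliary lemma): `mem_G_zero`. -/
theorem mem_G_zero {o z : ℕ} : z ∈ G D J o 0 ↔ z < 2 ^ L ∧ ¬ blocked D J (2 * L) z ∧ z = o := by
  simp [G]

/-- K\*\* cone (auxiliary lemma): `mem_G_succ`. -/
theorem mem_G_succ {o d z : ℕ} : z ∈ G D J o (d + 1) ↔ z < 2 ^ L ∧
    ¬ blocked D J (2 * L - (d + 1)) z ∧ (z ∈ G D J o d ∨ dbMirror L (2 * L - (d + 1)) z ∈ G D J o d) := by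
  simp [G]

/-- K\*\* cone (auxiliary lemma): `lt_of_mem_G`. -/
theorem lt_of_mem_G {o d z : ℕ} (h : z ∈ G D J o d) : z < 2 ^ L := by
  cases d with
  | zero => exact (mem_G_zero.1 h).1
  | succ d => exact (mem_G_succ.1 h).1

/-- K\*\* cone (auxiliary lemma): `unblocked_of_mem_G`. -/
theorem unblocked_of_mem_G {o d z : ℕ} (h : z ∈ G D J o d) : ¬ blocked D J (2 * L - d) z := by
  cases d with
  | zero => simpa using (mem_G_zero.1 h).2.1
  | succ d => exact (mem_G_succ.1 h).2.1

/-- (P3) Good vertices are avoiding ancestors of the top's birth. -/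
theorem beta_mem_anc_of_mem_G (o : ℕ) : ∀ d, 1 ≤ d → d ≤ 2 * L → ∀ z ∈ G D J o d,
    D.β (2 * L - d) z ∈ ancestorsAvoiding E J (D.β (2 * L) o) := by
  intro d
  induction d with
  | zero => intro h; omega
  | succ d ih =>
    intro _ hd z hz
    obtain ⟨hzM, hunb, hy⟩ := mem_G_succ.1 hz
    obtain ⟨hβz, hcar⟩ := (unblocked_iff D J).1 hunb
    -- pick the good out-neighbour y
    obtain ⟨y, hyG, hyeq⟩ : ∃ y, y ∈ G D J o d ∧ (y = z ∨ y = dbMirror L (2 * L - (d + 1)) z) := by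
      rcases hy with hy | hy
      · exact ⟨z, hy, Or.inl rfl⟩
      · exact ⟨_, hy, Or.inr rfl⟩
    have hyunb := unblocked_of_mem_G hyG
    obtain ⟨hβy, -⟩ := (unblocked_iff D J).1 hyunb
    have e : 2 * L - (d + 1) + 1 = 2 * L - d := by omega
    have hβy' : D.β (2 * L - (d + 1) + 1) y ∉ J := by rw [e]; exact hβy
    have hpath := D.path (2 * L - (d + 1)) z y (by omega) hzM hyeq J hβz hcar hβy'
    rw [e] at hpath
    rcases Nat.eq_zero_or_pos d with hd0 | hdpos
    · subst hd0
      obtain ⟨-, -, rfl⟩ := mem_G_zero.1 hyG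
      simpa using hpath
    · exact ancestorsAvoiding_trans hpath (ih hdpos (by omega) y hyG)

/-- Exponent bookkeeping for the upper levels: transition `2L-(d+1) → 2L-d` has block size `2^(d+1)`. -/
theorem block_exp_upper (hL : 1 ≤ L) {d : ℕ} (hd : d + 1 ≤ L) :
    L - (2 * L - (d + 1)) % L = d + 1 := by
  have e : 2 * L - (d + 1) = L + (L - (d + 1)) := by omega
  rw [e, Nat.add_mod_left, Nat.mod_eq_of_lt (by omega)]
  omega

/-- (G3) Funnel invariant: `G o d` lies in the `2^d`-block of `o`, and so does any `z` with `z` or its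
mirror in `G o d` one level down (block size doubles). -/
theorem div_eq_of_mem_G (hL : 1 ≤ L) (o : ℕ) : ∀ d, d ≤ L → ∀ z ∈ G D J o d, z / 2 ^ d = o / 2 ^ d := by
  intro d
  induction d with
  | zero => intro _ z hz; obtain ⟨-, -, rfl⟩ := mem_G_zero.1 hz; rfl
  | succ d ih =>
    intro hd z hz
    obtain ⟨hzM, -, hy⟩ := mem_G_succ.1 hz
    rcases hy with hy | hy
    · have := ih (by omega) z hy
      rw [pow_succ, ← Nat.div_div_eq_div_mul, ← Nat.div_div_eq_div_mul, this]
    · have h1 := ih (by omega) _ hy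
      have h2 : dbMirror L (2 * L - (d + 1)) z / 2 ^ (d + 1) = z / 2 ^ (d + 1) := by
        have := dbMirror_div L (2 * L - (d + 1)) z
        rwa [block_exp_upper hL hd] at this
      rw [← h2, pow_succ, ← Nat.div_div_eq_div_mul, ← Nat.div_div_eq_div_mul, h1]

/-- K\*\* cone (auxiliary lemma): `div_eq_of_mem_or_mirror`. -/
theorem div_eq_of_mem_or_mirror (hL : 1 ≤ L) {o d z : ℕ} (hd : d + 1 ≤ L)
    (hy : z ∈ G D J o d ∨ dbMirror L (2 * L - (d + 1)) z ∈ G D J o d) :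
    z / 2 ^ (d + 1) = o / 2 ^ (d + 1) := by
  rcases hy with hy | hy
  · have := div_eq_of_mem_G hL o d (by omega) z hy
    rw [pow_succ, ← Nat.div_div_eq_div_mul, ← Nat.div_div_eq_div_mul, this]
  · have h1 := div_eq_of_mem_G hL o d (by omega) _ hy
    have h2 : dbMirror L (2 * L - (d + 1)) z / 2 ^ (d + 1) = z / 2 ^ (d + 1) := by
      have := dbMirror_div L (2 * L - (d + 1)) z
      rwa [block_exp_upper hL hd] at this
    rw [← h2, pow_succ, ← Nat.div_div_eq_div_mul, ← Nat.div_div_eq_div_mul, h1]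

/-- (G4) Funnel step: one level down the good set doubles, up to the blocked vertices of that level
inside the `2^(d+1)`-block of `o`. -/
theorem funnel_step (hL : 1 ≤ L) {o d : ℕ} (hd : d + 1 ≤ L) :
    2 * (G D J o d).card ≤ (G D J o (d + 1)).card +
      ((Bl D J (2 * L - (d + 1))).filter (fun z => z / 2 ^ (d + 1) = o / 2 ^ (d + 1))).card := by
  classical
  set m := dbMirror L (2 * L - (d + 1)) with hm
  have hminv : ∀ a, m (m a) = a := fun a => dbMirror_dbMirror L _ a
  have hminj : Function.Injective m := Function.LeftInverse.injective hminv
  set Gd := G D J o d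
  set U := (range (2 ^ L)).filter (fun z => z ∈ Gd ∨ m z ∈ Gd) with hU
  -- U = Gd ∪ m '' Gd, disjointly
  have hGU : Gd ⊆ U := fun z hz => mem_filter.2 ⟨mem_range.2 (lt_of_mem_G hz), Or.inl hz⟩
  have hIU : Gd.image m ⊆ U := by
    intro z hz
    obtain ⟨g, hg, rfl⟩ := mem_image.1 hz
    refine mem_filter.2 ⟨mem_range.2 (dbMirror_lt (lt_of_mem_G hg)), Or.inr ?_⟩
    rw [hminv]; exact hg
  have hUsub : U ⊆ Gd ∪ Gd.image m := by
    intro z hz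
    rcases (mem_filter.1 hz).2 with h | h
    · exact mem_union_left _ h
    · exact mem_union_right _ (mem_image.2 ⟨m z, h, hminv z⟩)
  have hdisj : Disjoint Gd (Gd.image m) := by
    rw [disjoint_left]
    intro z hz hz'
    obtain ⟨g, hg, hgz⟩ := mem_image.1 hz'
    have h1 := div_eq_of_mem_G hL o d (by omega) z hz
    have h2 := div_eq_of_mem_G hL o d (by omega) g hg
    have hne : m g / 2 ^ d ≠ g / 2 ^ d :=
      dbMirror_div_half_ne (by rw [block_exp_upper hL hd, pow_succ, mul_comm]) (by positivity)
    rw [hgz, h1, h2] at hne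
    exact hne rfl
  have hcardU : U.card = 2 * Gd.card := by
    have : U = Gd ∪ Gd.image m := Subset.antisymm hUsub (union_subset hGU hIU)
    rw [this, card_union_of_disjoint hdisj, card_image_of_injective _ hminj]; ring
  -- U ⊆ G (d+1) ∪ (blocked of the level inside the block)
  have hU2 : U ⊆ G D J o (d + 1) ∪
      (Bl D J (2 * L - (d + 1))).filter (fun z => z / 2 ^ (d + 1) = o / 2 ^ (d + 1)) := by
    intro z hz
    obtain ⟨hzM, hy⟩ := mem_filter.1 hz
    by_cases hb : blocked D J (2 * L - (d + 1)) z
    · refine mem_union_right _ (mem_filter.2 ⟨mem_filter.2 ⟨hzM, hb⟩, ?_⟩)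
      exact div_eq_of_mem_or_mirror hL hd hy
    · exact mem_union_left _ (mem_G_succ.2 ⟨mem_range.1 hzM, hb, hy⟩)
  calc 2 * Gd.card = U.card := hcardU.symm
    _ ≤ _ := le_trans (card_le_card hU2) (card_union_le _ _)

/-- Counting the `2^(d+1)`-block of `o` over all `o`: each blocked `z` is met at most `2^(d+1)` times. -/
theorem sum_card_filter_div_le (S : Finset ℕ) (Dv : ℕ) (hDv : 0 < Dv) (M : ℕ) :
    ∑ o ∈ range M, (S.filter (fun z => z / Dv = o / Dv)).card ≤ Dv * S.card := by
  classical
  have hswap : ∑ o ∈ range M, (S.filter (fun z => z / Dv = o / Dv)).card =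
      ∑ z ∈ S, ((range M).filter (fun o => z / Dv = o / Dv)).card := by
    simp only [card_filter]
    rw [sum_comm]
  rw [hswap]
  have hle : ∀ z ∈ S, ((range M).filter (fun o => z / Dv = o / Dv)).card ≤ Dv := by
    intro z _
    have hsub : (range M).filter (fun o => z / Dv = o / Dv) ⊆ Finset.Ico (z / Dv * Dv) (z / Dv * Dv + Dv) := by
      intro o ho
      obtain ⟨-, ho⟩ := mem_filter.1 ho
      rw [Finset.mem_Ico]
      constructor
      · rw [ho]; exact Nat.div_mul_le_self o Dv
      · rw [ho]; exact Nat.lt_div_mul_add hDv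
    calc _ ≤ (Finset.Ico (z / Dv * Dv) (z / Dv * Dv + Dv)).card := card_le_card hsub
      _ = Dv := by simp
  calc ∑ z ∈ S, ((range M).filter (fun o => z / Dv = o / Dv)).card ≤ ∑ _z ∈ S, Dv := sum_le_sum hle
    _ = Dv * S.card := by rw [sum_const, smul_eq_mul, mul_comm]

/-- K\*\* cone (auxiliary lemma): `phi_zero`. -/
theorem phi_zero : 2 ^ L ≤ Phi (D := D) (J := J) 0 + Sbl (D := D) (J := J) 0 := by
  classical
  unfold Phi Sbl
  simp only [zero_add, range_one, sum_singleton, Nat.sub_zero]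
  have h1 : ∀ o ∈ range (2 ^ L), 1 ≤ (G D J o 0).card + (if blocked D J (2 * L) o then 1 else 0) := by
    intro o ho
    by_cases hb : blocked D J (2 * L) o
    · simp [hb]
    · have : o ∈ G D J o 0 := mem_G_zero.2 ⟨mem_range.1 ho, hb, rfl⟩
      rw [if_neg hb, add_zero]
      exact card_pos.2 ⟨o, this⟩
  have h2 : (Bl D J (2 * L)).card = ∑ o ∈ range (2 ^ L), (if blocked D J (2 * L) o then 1 else 0) := by
    unfold Bl; rw [card_filter]
  calc 2 ^ L = ∑ _o ∈ range (2 ^ L), 1 := by simp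
    _ ≤ ∑ o ∈ range (2 ^ L), ((G D J o 0).card + (if blocked D J (2 * L) o then 1 else 0)) := sum_le_sum h1
    _ = _ := by rw [sum_add_distrib, h2]

/-- K\*\* cone (auxiliary lemma): `phi_succ`. -/
theorem phi_succ (hL : 1 ≤ L) {d : ℕ} (hd : d + 1 ≤ L) :
    2 * Phi (D := D) (J := J) d ≤ Phi (D := D) (J := J) (d + 1) + 2 ^ (d + 1) * (Bl D J (2 * L - (d + 1))).card := by
  classical
  unfold Phi
  rw [mul_sum]
  calc ∑ o ∈ range (2 ^ L), 2 * (G D J o d).card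
      ≤ ∑ o ∈ range (2 ^ L), ((G D J o (d + 1)).card +
          ((Bl D J (2 * L - (d + 1))).filter (fun z => z / 2 ^ (d + 1) = o / 2 ^ (d + 1))).card) :=
        sum_le_sum (fun o _ => funnel_step hL hd)
    _ = ∑ o ∈ range (2 ^ L), (G D J o (d + 1)).card + ∑ o ∈ range (2 ^ L),
          ((Bl D J (2 * L - (d + 1))).filter (fun z => z / 2 ^ (d + 1) = o / 2 ^ (d + 1))).card :=
        sum_add_distrib
    _ ≤ _ := Nat.add_le_add_left (sum_card_filter_div_le _ _ (by positivity) _) _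

/-- K\*\* cone (auxiliary lemma): `sbl_succ`. -/
theorem sbl_succ (d : ℕ) : Sbl (D := D) (J := J) (d + 1) = Sbl (D := D) (J := J) d + (Bl D J (2 * L - (d + 1))).card := by
  unfold Sbl; rw [sum_range_succ]

/-- (G6) The funnel potential bound: `2^d · M ≤ Φ d + 2^d · S d` for `d ≤ L`. -/
theorem phi_bound (hL : 1 ≤ L) : ∀ d, d ≤ L → 2 ^ d * 2 ^ L ≤ Phi (D := D) (J := J) d + 2 ^ d * Sbl (D := D) (J := J) d := by
  intro d
  induction d with
  | zero => intro _; simpa using phi_zero (D := D) (J := J)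
  | succ d ih =>
    intro hd
    have h1 := ih (by omega)
    have h2 := phi_succ (D := D) (J := J) hL hd
    rw [pow_succ] at h2
    rw [sbl_succ, pow_succ]
    linarith [h1, h2]

/-- (G8) Lower levels: the good set loses at most the blocked vertices of the next level down. -/
theorem card_G_le_succ {o : ℕ} (d : ℕ) :
    (G D J o d).card ≤ (G D J o (d + 1)).card + (Bl D J (2 * L - (d + 1))).card := by
  classical
  have : G D J o d ⊆ G D J o (d + 1) ∪ Bl D J (2 * L - (d + 1)) := by
    intro z hz
    have hzM := lt_of_mem_G hz
    by_cases hb : blocked D J (2 * L - (d + 1)) z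
    · exact mem_union_right _ (mem_filter.2 ⟨mem_range.2 hzM, hb⟩)
    · exact mem_union_left _ (mem_G_succ.2 ⟨hzM, hb, Or.inl hz⟩)
  exact le_trans (card_le_card this) (card_union_le _ _)

/-- (G9) All partial sums are bounded by the total number of blocked vertices. -/
theorem sbl_le_card_Bltot {d : ℕ} (hd : d ≤ 2 * L) : Sbl (D := D) (J := J) d ≤ (Bltot D J).card := by
  unfold Sbl
  have hfull : ∑ j ∈ range (2 * L + 1), (Bl D J (2 * L - j)).card = (Bltot D J).card := by
    rw [card_Bltot_eq]
    have := sum_range_reflect (fun j => (Bl D J j).card) (2 * L + 1)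
    simp only [Nat.add_sub_cancel] at this
    convert this using 2
  rw [← hfull]
  exact sum_le_sum_of_subset (by intro j hj; rw [mem_range] at hj ⊢; omega)

end Count

/-! #### Assembly of the count -/

section Final

variable {L T κ : ℕ} {E : Finset (ℕ × ℕ)} {D : ChargedDB L T κ E} {J : Finset ℕ}

/-- K\*\* cone (auxiliary lemma): `unblocked_top_of_G_nonempty`. -/
theorem unblocked_top_of_G_nonempty {o : ℕ} : ∀ d, (G D J o d).Nonempty → ¬ blocked D J (2 * L) o := by
  intro d
  induction d with
  | zero =>
    rintro ⟨z, hz⟩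
    obtain ⟨-, hb, rfl⟩ := mem_G_zero.1 hz
    exact hb
  | succ d ih =>
    rintro ⟨z, hz⟩
    obtain ⟨-, -, hy⟩ := mem_G_succ.1 hz
    rcases hy with hy | hy
    · exact ih ⟨z, hy⟩
    · exact ih ⟨_, hy⟩

/-- Lower levels keep the funnel's mass: `M ≤ |G o d| + S d` for all `d ≥ L` once it holds at `d = L`. -/
theorem lower_bound_G {o : ℕ} (hLo : 2 ^ L ≤ (G D J o L).card + Sbl (D := D) (J := J) L) :
    ∀ d, L ≤ d → 2 ^ L ≤ (G D J o d).card + Sbl (D := D) (J := J) d := by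
  intro d hd
  induction d, hd using Nat.le_induction with
  | base => exact hLo
  | succ n hn ih =>
    have h1 := card_G_le_succ (D := D) (J := J) (o := o) n
    rw [sbl_succ]
    omega

end Final

end KSSCount

end Summit.PneNP.PneNP.Theorems.RootDecompSegregatorSmallSegregators.Negative
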